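import Summits.ABC.IUTFork.Repair.RHHeightClassGlue
import Summits.ABC.IUTFork.Repair.RHSlotReachGlue
import HarnessLib

/-!
# D-0079 RESCUE sub-cell R-H, ROUND 1 row 8 «heightclass» — the END-TO-END k2 DOOR as ONE named theorem:
# `HBand X` (+ its datum-level dictionary certificates) ⟹ `∃ ρ qK, QPinned ∧ PilotKummerCompatHull` at `settingPrVolSharp X …` (the hSHw shape)

PROOF-ONLY composition file (D-0012: 0 definitions, 0 `Prop` facts; abc-iut cell, rung LADDER-ABC:A2.RESCUE.H; seat abc-iut-rh-typ-8 gen 0 = R-H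
ROUND 1 PAIR n = 8 TYPER; referee condition abc-iut-rh-ref-2 2026-08-26T18:10:48Z «I sign KEEP-on-slice(HEX k ≤ k₀) IFF the slice-stratum k2 door is a
LANDED named theorem (rp-m2 'RHHeightClassGlue' HBand-cell ⟹ SlotReachWindow-cell composed with a row-15 mover at the slice packets)»). NOTHING is proved
here beyond a composition BY NAME of two landed theorems: abc-iut-rp-m2's `RHHeightClassGlue.slotReachWindow_of_hBand` (p460910: the row-8 candidate
`RHHeightClass.HBand X` of abc-iut-lens-strengthen-1, filed by this seat p459046, IMPLIES abc-iut-lens-wuc-1's row-15 `RHSlotReach.SlotReachWindow` at the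
dictionary `n₀ ≡ 1`, `λ_p = −r_p/e_p`, `mΘ = j²·m_q`) and abc-iut-rp-d3's `RHSlotReachGlue.exists_qPinned_and_hull_settingPrVolSharp_of_slotReachWindow`
(the MOVER lemma `multiReach_of_slotReachWindow` proved ⟹ branch C's antecedent at abc-iut-c312-7's `Thm311.Real.settingPrVolSharp`). TAKES NO SIDE on
[IUTchIII] Cor. 3.12 or on any author; `HBand` is a HYPOTHESIS (claim-tagged), the dictionary certificates and idele-norm binders are hypotheses on the
genuine bed exactly as in every door of record (`Conditional.abc_of_SH_v10K_window` p447945's `hSHw` consumes the conclusion); typed ≠ proved;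
instantiated ≠ endorsed. [cite: DupuyHilado2025, §3.9, §4.9] [cite: WeilBNT1967, Ch. II §2, Th. 1] [claim: Mochizuki2012, status: disputed]. Axioms: standard.
-/

noncomputable section

open Set Function
open scoped Pointwise

namespace Summit.ABC.IUTFork.Repair.RHHeightClassDoor

open Thm311 Thm311.Real Cor312 Cor312.Setting Cor312Vol Literature.IUT.LogThetaLattice Literature.IUT.LogVolume
open Literature.NumberTheory.NumberFields NumberField IsDedekindDomain Metric

section Setting

variable {F : Type} [Field F] [NumberField F] (X : PilotData F) {logv : PadicLogs F} (hlog : LogvAnalytic logv)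
  (M : Type) [Field M] [NumberField M]
  (archPk : ∀ (j : (thetaIndex X).Label) (vQ : (thetaIndex X).VQ), Set ((logShellsDH X logv).Packet j vQ))
  (archSub : ∀ (j : (thetaIndex X).Label) (v : (thetaIndex X).V),
    Set ((logShellsDH X logv).Packet j ((thetaIndex X).over v)))
  (Ψ : ℤ → ∀ v : (thetaIndex X).V, v ∈ (thetaIndex X).Vbad → Set ((logShellsDH X logv).StarPacket v))
  (act : ℤ → ∀ v : (thetaIndex X).V, v ∈ (thetaIndex X).Vbad →
    (logShellsDH X logv).StarPacket v → Module.End ℚ ((logShellsDH X logv).StarPacket v))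
  (Mmod : ℤ → ∀ j : (thetaIndex X).LabelStar, Set ((logShellsDH X logv).GlobalPacket j.1))
  (region : ℤ → ∀ j : (thetaIndex X).LabelStar, FinDivisor M → ∀ vQ : (thetaIndex X).VQ,
    Set ((logShellsDH X logv).Packet j.1 vQ))
  (n : ℤ) {HT : Type} {LogLink : HT → HT → Type} {IsFull : ∀ {s t : HT}, LogLink s t → Prop}
  (lat : LGPGaussianLogThetaLattice LogLink IsFull)
  {Frd : Type} {IsoF : Frd → Frd → Type} {Ob : Frd → Type} {realify : Frd → Frd} {Strip : Type}
  {IsoS : Strip → Strip → Type} {Mv : ∀ v : (thetaIndex X).V, v ∈ (thetaIndex X).Vbad → Type}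
  [∀ v h, Monoid (Mv v h)]
  (sig : GlobalLGPFrobenioidSignature (thetaIndex X).lstar (thetaIndex X).V (· ∈ (thetaIndex X).Vbad)
    Frd IsoF Ob realify Strip IsoS Mv)
  (split : SplittingMonoids Mv) {ObΔ : Type} {N : ∀ v : (thetaIndex X).V, v ∈ (thetaIndex X).Vbad → Type}
  [∀ v h, Monoid (N v h)] (qData : QPilotData ObΔ N)
  (tq : ∀ (pp : Nat.Primes) (x : (thetaIndex X).Fibre (.inr pp)), haveI : Fact (pp : ℕ).Prime := ⟨pp.2⟩; kOf X pp.1 x)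
  (t : ∀ (pp : Nat.Primes) (_ : Fin X.lstar) (x : (thetaIndex X).Fibre (.inr pp)),
    haveI : Fact (pp : ℕ).Prime := ⟨pp.2⟩; kOf X pp.1 x)
  (htq0 : ∀ pp x, tq pp x ≠ 0)
  (htq1 : ∀ (pp : Nat.Primes) (x : (thetaIndex X).Fibre (.inr pp)),
    haveI : Fact (pp : ℕ).Prime := ⟨pp.2⟩; placeOf X pp.1 x ∉ X.S → ‖tq pp x‖ = 1)
  (col : ℤ → Column (logShellsDH X logv))
  -- row 8's DATUM-LEVEL dictionary: per prime `p` ONE ramification index `e_p` and ONE certified member valuation `r_p` (uniform fibres),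
  -- a norm uniformizer per place, and the integer idele orders
  (eK : Nat.Primes → ℕ) (rK : Nat.Primes → ℤ)
  (ϖ : ∀ (pp : Nat.Primes) (x : (thetaIndex X).Fibre (.inr pp)), haveI : Fact (pp : ℕ).Prime := ⟨pp.2⟩; kOf X pp.1 x)
  (mq : ∀ pp : Nat.Primes, (thetaIndex X).Fibre (.inr pp) → ℤ)

/-- **ROW 8's k2 DOOR, END TO END.** For ANY pilot datum `X` at the print-normalised sharp genuine setting `settingPrVolSharp X …`: if the ROUND-1 row-8
candidate `RHHeightClass.HBand X` holds, then — given its datum-level dictionary (`e_p = ramIdx` on the bad fibre over `p`, `r_p ≤` every `CertVal` value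
there, e.g. `r_p = r♯` untied by `RHHeightClassGlue.hrK_of_strictMinPow` or `r_p = e_p` at a tie by `hrK_of_tie`), the two per-place certificates of the
row-15 window at `(n₀, λ) = (1, −r_p/e_p)` (a non-log-unit of norm `≤ 1`: `RHSlotReach.exists_hsharp_one`; a log-unit of norm `≥ p^{−r_p/e_p}`:
`RHHeightClassGlue.exists_mem_logUnits_rpow_le_of_certVal`), norm uniformizers `‖ϖ_x‖ = p^{−1/e_p}`, and the honest idele profile (`‖t_{q,w}‖ = ‖ϖ_w‖^{m_q(w)}`,
`‖t_{Θ,j,w}‖ = ‖ϖ_w‖^{j²·m_q(w)}`, `m_q(w) = P_q(w)` at bad `w`, `‖t‖ = 1` off `S`, `‖t_q‖ ≤ 1`) — branch C's antecedent holds: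
`∃ ρ qK, QPinned ∧ PilotKummerCompatHull`, the binder `hSHw` of the window certificates. PROOF = abc-iut-rp-m2's `slotReachWindow_of_hBand` (p460910) fed to
abc-iut-rp-d3's `exists_qPinned_and_hull_settingPrVolSharp_of_slotReachWindow` (`RHSlotReachGlue`, mover proved); nothing else.
[cite: DupuyHilado2025, §3.9, §4.9] [cite: WeilBNT1967, Ch. II §2, Th. 1] [claim: Mochizuki2012, status: disputed] -/
theorem exists_qPinned_and_hull_settingPrVolSharp_of_hBand (htqle : ∀ pp x, ‖tq pp x‖ ≤ 1)
    (heK : ∀ pp, 1 ≤ eK pp)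
    (hram : ∀ (pp : Nat.Primes) (w : (thetaIndex X).Fibre (.inr pp)), haveI : Fact (pp : ℕ).Prime := ⟨pp.2⟩
      placeOf X pp.1 w ∈ X.S → ramIdx F (placeOf X pp.1 w) = eK pp)
    (hrK : ∀ (pp : Nat.Primes) (w : (thetaIndex X).Fibre (.inr pp)), haveI : Fact (pp : ℕ).Prime := ⟨pp.2⟩
      placeOf X pp.1 w ∈ X.S → ∀ r : ℤ, RHHeightClass.CertVal pp (eK pp) r → rK pp ≤ r)
    (hϖ : ∀ (pp : Nat.Primes) (x : (thetaIndex X).Fibre (.inr pp)), haveI : Fact (pp : ℕ).Prime := ⟨pp.2⟩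
      ‖ϖ pp x‖ = (pp : ℝ) ^ (-(1 : ℝ) / ((eK pp : ℕ) : ℝ)))
    (hsharp : ∀ (pp : Nat.Primes) (x : (thetaIndex X).Fibre (.inr pp)), haveI : Fact (pp : ℕ).Prime := ⟨pp.2⟩
      ∃ u : kOf X pp.1 x, ‖u‖ ≤ ‖ϖ pp x‖ ^ (((1 : ℕ) : ℤ) - 1) ∧ u ∉ (logUnits (kOf X pp.1 x) : Set (kOf X pp.1 x)))
    (hrad : ∀ (pp : Nat.Primes) (x : (thetaIndex X).Fibre (.inr pp)), haveI : Fact (pp : ℕ).Prime := ⟨pp.2⟩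
      ∃ z ∈ (logUnits (kOf X pp.1 x) : Set (kOf X pp.1 x)), (pp : ℝ) ^ (-((rK pp : ℤ) : ℝ) / ((eK pp : ℕ) : ℝ)) ≤ ‖z‖)
    (ht1 : ∀ (pp : Nat.Primes) (i : Fin X.lstar) (x : (thetaIndex X).Fibre (.inr pp)),
      haveI : Fact (pp : ℕ).Prime := ⟨pp.2⟩; placeOf X pp.1 x ∉ X.S → ‖t pp i x‖ = 1)
    (hΘ : ∀ (pp : Nat.Primes) (i : Fin X.lstar) (w : (thetaIndex X).Fibre (.inr pp)), haveI : Fact (pp : ℕ).Prime := ⟨pp.2⟩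
      placeOf X pp.1 w ∈ X.S → ‖t pp i w‖ = ‖ϖ pp w‖ ^ ((((((i : ℕ) : ℤ) + 1) ^ 2) * mq pp w)))
    (hq : ∀ (pp : Nat.Primes) (w : (thetaIndex X).Fibre (.inr pp)), haveI : Fact (pp : ℕ).Prime := ⟨pp.2⟩
      placeOf X pp.1 w ∈ X.S → ‖tq pp w‖ = ‖ϖ pp w‖ ^ (mq pp w))
    (hmq : ∀ (pp : Nat.Primes) (w : (thetaIndex X).Fibre (.inr pp)), haveI : Fact (pp : ℕ).Prime := ⟨pp.2⟩
      placeOf X pp.1 w ∈ X.S → (mq pp w : ℝ) = X.qPilot (placeOf X pp.1 w))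
    (hH : RHHeightClass.HBand X) :
    ∃ (ρ : (∀ v : (thetaIndex X).V, v ∈ (thetaIndex X).Vbad → Set ((logShellsDH X logv).StarPacket v)) →
          ∀ (j : (thetaIndex X).Label) (vQ : (thetaIndex X).VQ), Set ((logShellsDH X logv).Packet j vQ))
        (qK : ∀ v : (thetaIndex X).V, v ∈ (thetaIndex X).Vbad → Set ((logShellsDH X logv).StarPacket v)),
        QPinned ({ toSituation := situationPrVol X hlog M archPk archSub Ψ act Mmod region, col := col } :
            LatticeSituation (thetaIndex X))
          (settingPrVolSharp X hlog M archPk archSub Ψ act Mmod region n lat sig split qData tq t htq0 htq1) ρ qK ∧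
        PilotKummerCompatHull ({ toSituation := situationPrVol X hlog M archPk archSub Ψ act Mmod region, col := col } :
            LatticeSituation (thetaIndex X))
          (settingPrVolSharp X hlog M archPk archSub Ψ act Mmod region n lat sig split qData tq t htq0 htq1) ρ qK := by
  -- the window of row 15 at row 8's dictionary (abc-iut-rp-m2, p460910)
  have hW := RHHeightClassGlue.slotReachWindow_of_hBand X eK rK heK
    (e := fun pp _ => eK pp) (n₀ := fun _ _ => 1) (lam := fun pp _ => -((rK pp : ℤ) : ℝ) / ((eK pp : ℕ) : ℝ))
    (mΘ := fun pp i w => ((((i : ℕ) : ℤ) + 1) ^ 2) * mq pp w) (mq := mq)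
    (fun _ _ => rfl) (fun _ _ => rfl) (fun _ _ => rfl) (fun _ _ _ => rfl) hram hmq hrK hH
  -- fed to the mover door (abc-iut-rp-d3, RHSlotReachGlue)
  exact RHSlotReachGlue.exists_qPinned_and_hull_settingPrVolSharp_of_slotReachWindow X hlog M archPk archSub Ψ act Mmod region n lat sig
    split qData tq t htq0 htq1 col (fun pp _ => eK pp) (fun _ _ => 1) (fun pp _ => -((rK pp : ℤ) : ℝ) / ((eK pp : ℕ) : ℝ)) ϖ
    (fun pp i w => ((((i : ℕ) : ℤ) + 1) ^ 2) * mq pp w) mq htqle (fun pp _ => heK pp) hϖ hsharp hrad ht1 hΘ hq hW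

end Setting

end Summit.ABC.IUTFork.Repair.RHHeightClassDoor

end
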